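import Mathlib
import HarnessLib
import Summits.AnomalousDissipation.AnomalousDissipation.Theses.DecimationAxis
import Literature.Analysis.FluidPDE.GalerkinFlow
import Literature.Analysis.FluidPDE.LongTimeAverageShift
import Literature.Analysis.FluidPDE.TimeAverageMeasureBasic

/-!
# STUB-PLAN companion for `stub_absorbedWitness` (crux `DecimationAxis.UniformEquilibration`,
item stmt-AnomalousDissipation-1583, skeleton `Cruxes/UniformEquilibration/Lines/birth.lean`)

Stub critic's consolidated file: the merged helper set of the three STUB-IDEAS plans
(k3's architecture — signed Grönwall over `IsGalerkinODESolution` with a free force bound `Φsq`;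
k1's proved bookkeeping; the `liminf` shift twin for bounded observables) and the assembly
`stub_absorbedWitness : Sig.stub_absorbedWitness`. Vocabulary (§0) copied verbatim from the skeleton.
-/

set_option linter.dupNamespace false

noncomputable section

namespace Summit.AnomalousDissipation.AnomalousDissipation.Cruxes.UniformEquilibration.StubPlan

open scoped BigOperators Topology Classical MeasureTheory InnerProductSpace ComplexConjugate
open Filter Set Function MeasureTheory
open Literature.Analysis.FunctionSpaces Literature.Analysis.FunctionSpaces.Torus
open Literature.Analysis.FluidPDE
open Summit.AnomalousDissipation.AnomalousDissipation.Theses.DecimationAxis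

/-- Integer frequencies (local notation). -/
local notation "ℤ³" => Fin 3 → ℤ
/-- Complex Fourier coefficient vectors (local notation). -/
local notation "ℂ³" => EuclideanSpace ℂ (Fin 3)

/-! ### §0 Vocabulary (verbatim from `Lines/birth.lean`) -/

/-- The crux's solution notion (verbatim copy of the skeleton's `IsCoeffTrajectory`). -/
def IsCoeffTrajectory (S : Finset ℤ³) (ν : ℝ) (g : ℤ³ → ℂ³) (c : ℝ → ↥S → ℂ³) : Prop :=
  (∀ t, c t ∈ galerkinSubspace S) ∧ ContinuousOn c (Set.Ici 0) ∧
    ∀ T : ℝ, ∀ t ∈ Set.Icc (0 : ℝ) T,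
      HasDerivWithinAt c (galerkinRHS S ν (fun k => g k) (c t)) (Set.Icc 0 T) t

/-- Modal energy (verbatim copy). -/
def modalEnergy {S : Finset ℤ³} (a : ↥S → ℂ³) : ℝ :=
  ∑ k : ↥S, ‖a k‖ ^ 2

/-- Resolved dissipation (verbatim copy). -/
def resolvedDissipation {S : Finset ℤ³} (ν : ℝ) (M : ℕ) (a : ↥S → ℂ³) : ℝ :=
  ν * (4 * Real.pi ^ 2 * ∑ k : ↥S,
    if freqNormSq (k : ℤ³) ≤ (M : ℝ) ^ 2 then freqNormSq (k : ℤ³) * ‖a k‖ ^ 2 else 0)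

/-- The registered stub signature (verbatim copy). -/
def Sig.stub_absorbedWitness : Prop :=
  ∀ (ν : ℝ), 0 < ν → ∀ (N : ℕ) (g : ℤ³ → ℂ³), IsConjSymm g → (∀ k, k ∉ freqBall N → g k = 0) →
    g 0 = 0 → (∀ k : ℤ³, ∑ i, ((k i : ℤ) : ℂ) * g k i = 0) →
    ∃ B : ℝ, ∀ (E ε : ℝ) (M K : ℕ) (S : Finset ℤ³), S = (freqBall K).erase 0 →
      (∃ c : ℝ → ↥S → ℂ³, IsCoeffTrajectory S ν g c ∧
          longTimeAvgSup (fun t => modalEnergy (c t)) ≤ E ∧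
          2 * ε ≤ longTimeAvgInf (fun t => resolvedDissipation ν M (c t))) →
      ∃ c : ℝ → ↥S → ℂ³, IsCoeffTrajectory S ν g c ∧ (∀ t, 0 ≤ t → modalEnergy (c t) ≤ B) ∧
          longTimeAvgSup (fun t => modalEnergy (c t)) ≤ E ∧
          2 * ε ≤ longTimeAvgInf (fun t => resolvedDissipation ν M (c t))

/-! ### §1 Signed Grönwall (H1, H2: Mathlib wrappers, proved by k3) -/

/-- **H1.** Grönwall with a SIGNED rate in right-derivative form:
`f' ≤ K f + ε` on `[a,b)` ⇒ `f x ≤ gronwallBound δ K ε (x - a)`; `K < 0` allowed. [folklore] -/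
theorem le_gronwallBound_of_deriv_right_le {f f' : ℝ → ℝ} {δ K ε a b : ℝ}
    (hf : ContinuousOn f (Icc a b)) (hf' : ∀ x ∈ Ico a b, HasDerivWithinAt f (f' x) (Ici x) x)
    (ha : f a ≤ δ) (bound : ∀ x ∈ Ico a b, f' x ≤ K * f x + ε) :
    ∀ x ∈ Icc a b, f x ≤ gronwallBound δ K ε (x - a) :=
  le_gronwallBound_of_liminf_deriv_right_le hf
    (fun x hx _r hr => (hf' x hx).liminf_right_slope_le hr) ha bound

/-- **H2.** The Grönwall majorant with negative rate is below `δe^{-ax} + ε/a`. [folklore] -/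
theorem gronwallBound_neg_le {δ a ε x : ℝ} (ha : 0 < a) (hε : 0 ≤ ε) (hx : 0 ≤ x) :
    gronwallBound δ (-a) ε x ≤ δ * Real.exp (-a * x) + ε / a := by
  rw [gronwallBound_of_K_ne_0 (neg_ne_zero.2 ha.ne')]
  dsimp only
  have h1 : 0 < Real.exp (-a * x) := Real.exp_pos _
  have h2 : Real.exp (-a * x) ≤ 1 := by rw [Real.exp_le_one_iff]; nlinarith
  have h3 : ε / (-a) * (Real.exp (-a * x) - 1) = ε / a * (1 - Real.exp (-a * x)) := by
    field_simp; ring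
  rw [h3]
  have h4 : 0 ≤ ε / a := div_nonneg hε ha.le
  nlinarith [mul_le_mul_of_nonneg_left h2 h4]

/-! ### §2 The slice inequality and the `K`-uniform decay (H3, H4: the two Galerkin helpers) -/

/-- **Lattice Poincaré** `|k|² ≥ 1` for `k ≠ 0` (inline copy: the tree's two homonymous
`one_le_freqNormSq_of_ne_zero` — `TorusInverseLaplacian`, `DoeringFoiasPowerProofs` — are NOT in
the import closure of the skeleton's imports). [folklore] -/
theorem one_le_freqNormSq_of_ne_zero' {k : ℤ³} (hk : k ≠ 0) : 1 ≤ freqNormSq k := by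
  obtain ⟨i, hi⟩ : ∃ i, k i ≠ 0 := by
    by_contra h
    exact hk (funext fun i => by simpa using not_exists.1 h i)
  have h1 : (1 : ℝ) ≤ ((k i : ℝ)) ^ 2 := by
    have : (1 : ℤ) ≤ (k i) ^ 2 := by
      have h0 : 0 < (k i) ^ 2 := by positivity
      omega
    exact_mod_cast this
  exact h1.trans (Finset.single_le_sum (f := fun j => ((k j : ℝ)) ^ 2) (fun j _ => sq_nonneg _)
    (Finset.mem_univ i))

/-- **H3 (slice inequality on `S ∌ 0`, linear-damping normal form).** Energy flux
`≤ -(4π²ν)·Σ‖c_k‖² + Φ²/(4π²ν)`: Parseval (`toReal_eGradNormSq_coeffExt`,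
`integral_inner_realTrigPoly_realTrigPoly`), lattice Poincaré `|k|² ≥ 1` on `S ∌ 0` and termwise
Young `2Re⟪g_k,c_k⟫ ≤ ‖g_k‖²/(4π²ν) + 4π²ν‖c_k‖²` (sharpening of the tree's `energy_deriv_le`). [folklore] -/
theorem energyFlux_le {S : Finset ℤ³} (hS : ∀ k ∈ S, -k ∈ S) (h0 : (0 : ℤ³) ∉ S) {ν : ℝ}
    (hν : 0 < ν) {g c : ↥S → ℂ³} (hg : IsRealCoeff g) (hc : c ∈ galerkinSubspace S) {Φsq : ℝ}
    (hgΦ : ∑ k, ‖g k‖ ^ 2 ≤ Φsq) :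
    2 * (-(ν * (eGradNormSq (realTrigPoly S (coeffExt S c))).toReal) +
        ∫ x, ⟪realTrigPoly S (coeffExt S g) x, realTrigPoly S (coeffExt S c) x⟫_ℝ) ≤
      -(4 * Real.pi ^ 2 * ν) * (∑ k, ‖c k‖ ^ 2) + Φsq / (4 * Real.pi ^ 2 * ν) := by
  set lam : ℝ := 4 * Real.pi ^ 2 * ν with hlam
  have hlam0 : 0 < lam := by positivity
  -- Parseval for the injection term (the `hP` block of the tree's `energy_deriv_le`)
  have hP : ∫ x, ⟪realTrigPoly S (coeffExt S g) x, realTrigPoly S (coeffExt S c) x⟫_ℝ =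
      ∑ k, (inner ℂ (g k) (c k)).re := by
    rw [integral_inner_realTrigPoly_realTrigPoly hS (hg.isConjSymm_coeffExt hS)
      (hc.1.isConjSymm_coeffExt hS), ← Finset.sum_coe_sort]
    exact Finset.sum_congr rfl fun k _ => by rw [coeffExt_coe, coeffExt_coe]
  -- Parseval + lattice Poincaré for the dissipation term
  have hD : lam * ∑ k, ‖c k‖ ^ 2 ≤ ν * (eGradNormSq (realTrigPoly S (coeffExt S c))).toReal := by
    rw [toReal_eGradNormSq_coeffExt hS hc.1]
    have hsum : ∑ k : ↥S, ‖c k‖ ^ 2 ≤ ∑ k : ↥S, freqNormSq (k : ℤ³) * ‖c k‖ ^ 2 := by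
      refine Finset.sum_le_sum fun k _ => ?_
      have hk0 : (k : ℤ³) ≠ 0 := fun h => h0 (h ▸ k.2)
      have h1 : 1 ≤ freqNormSq (k : ℤ³) := one_le_freqNormSq_of_ne_zero' hk0
      nlinarith [sq_nonneg ‖c k‖]
    have : lam * ∑ k, ‖c k‖ ^ 2 ≤ lam * ∑ k : ↥S, freqNormSq (k : ℤ³) * ‖c k‖ ^ 2 :=
      mul_le_mul_of_nonneg_left hsum hlam0.le
    calc lam * ∑ k, ‖c k‖ ^ 2 ≤ lam * ∑ k : ↥S, freqNormSq (k : ℤ³) * ‖c k‖ ^ 2 := this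
      _ = ν * (4 * Real.pi ^ 2 * ∑ k : ↥S, freqNormSq (k : ℤ³) * ‖c k‖ ^ 2) := by
          rw [hlam]; ring
  -- termwise Young
  have hY : ∀ k : ↥S, 2 * (inner ℂ (g k) (c k)).re ≤ ‖g k‖ ^ 2 / lam + lam * ‖c k‖ ^ 2 := by
    intro k
    have h1 : (inner ℂ (g k) (c k)).re ≤ ‖g k‖ * ‖c k‖ := re_inner_le_norm (𝕜 := ℂ) (g k) (c k)
    have h2 : 2 * (‖g k‖ * ‖c k‖) ≤ ‖g k‖ ^ 2 / lam + lam * ‖c k‖ ^ 2 := by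
      rw [div_add' _ _ _ hlam0.ne', le_div_iff₀ hlam0]
      nlinarith [sq_nonneg (‖g k‖ - lam * ‖c k‖)]
    linarith
  have hsumY : ∑ k, 2 * (inner ℂ (g k) (c k)).re ≤
      (∑ k, ‖g k‖ ^ 2) / lam + lam * ∑ k, ‖c k‖ ^ 2 := by
    calc ∑ k, 2 * (inner ℂ (g k) (c k)).re ≤ ∑ k, (‖g k‖ ^ 2 / lam + lam * ‖c k‖ ^ 2) :=
          Finset.sum_le_sum fun k _ => hY k
      _ = (∑ k, ‖g k‖ ^ 2) / lam + lam * ∑ k, ‖c k‖ ^ 2 := by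
          rw [Finset.sum_add_distrib, Finset.sum_div, Finset.mul_sum]
  have hgl : (∑ k, ‖g k‖ ^ 2) / lam ≤ Φsq / lam := div_le_div_of_nonneg_right hgΦ hlam0.le
  have h2 : 2 * ∑ k, (inner ℂ (g k) (c k)).re = ∑ k, 2 * (inner ℂ (g k) (c k)).re := by
    rw [Finset.mul_sum]
  rw [hP]
  linarith

/-- **H4 (`K`-uniform exponential entrance + confinement).** Along a global Galerkin solution on a
symmetric `S ∌ 0`, `ν > 0`, real force with `Σ‖g_k‖² ≤ Φ²`:
`Σ‖α t k‖² ≤ Σ‖c₀ k‖²·e^{-4π²ν t} + Φ²/(4π²ν)²` for `t ≥ 0` (`hasDerivWithinAt_energy` + H3 feed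
H1 on `[0,t]` with `K = -4π²ν`, `ε = Φ²/(4π²ν)`; H2 bounds the majorant). Doering–Gibbon 1995
(5.3.38)–(5.3.39); Constantin–Foias 1988 (8.9); FMRT 2001 (A.41)–(A.42). [folklore] -/
theorem modalEnergy_le_exp {S : Finset ℤ³} (hS : ∀ k ∈ S, -k ∈ S) (h0 : (0 : ℤ³) ∉ S) {ν : ℝ}
    (hν : 0 < ν) {g c₀ : ↥S → ℂ³} {α : ℝ → ↥S → ℂ³} (hg : IsRealCoeff g)
    (hsol : IsGalerkinODESolution ν g c₀ α) {Φsq : ℝ} (hgΦ : ∑ k, ‖g k‖ ^ 2 ≤ Φsq) {t : ℝ}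
    (ht : 0 ≤ t) :
    ∑ k, ‖α t k‖ ^ 2 ≤
      (∑ k, ‖c₀ k‖ ^ 2) * Real.exp (-(4 * Real.pi ^ 2 * ν) * t) +
        Φsq / (4 * Real.pi ^ 2 * ν) ^ 2 := by
  set ψ : ℝ → ℝ := fun τ => ∑ k, ‖α τ k‖ ^ 2 with hψ
  set ψ' : ℝ → ℝ := fun τ =>
    2 * (-(ν * (eGradNormSq (realTrigPoly S (coeffExt S (α τ)))).toReal) +
      ∫ x, ⟪realTrigPoly S (coeffExt S g) x, realTrigPoly S (coeffExt S (α τ)) x⟫_ℝ) with hψ'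
  have hderiv : ∀ τ ∈ Icc 0 t, HasDerivWithinAt ψ (ψ' τ) (Icc 0 t) τ := fun τ hτ =>
    hasDerivWithinAt_energy ν hS (hsol.hasDerivWithinAt t τ hτ) (hsol.mem τ) hg
  have hcont : ContinuousOn ψ (Icc 0 t) := fun τ hτ => (hderiv τ hτ).continuousWithinAt
  have hderiv' : ∀ τ ∈ Ico 0 t, HasDerivWithinAt ψ (ψ' τ) (Ici τ) τ := fun τ hτ =>
    hasDerivWithinAt_energy ν hS (hsol.hasDerivWithinAt_Ici hτ) (hsol.mem τ) hg
  have hbound : ∀ τ ∈ Ico 0 t,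
      ψ' τ ≤ -(4 * Real.pi ^ 2 * ν) * ψ τ + Φsq / (4 * Real.pi ^ 2 * ν) := fun τ _ =>
    energyFlux_le hS h0 hν hg (hsol.mem τ) hgΦ
  have hψ0 : ψ 0 ≤ ∑ k, ‖c₀ k‖ ^ 2 := by
    simp only [hψ, hsol.initial]
    exact le_rfl
  have hgron := le_gronwallBound_of_deriv_right_le hcont hderiv' hψ0 hbound t ⟨ht, le_rfl⟩
  rw [sub_zero] at hgron
  have ha : 0 < 4 * Real.pi ^ 2 * ν := by positivity
  have hΦ : 0 ≤ Φsq := (Finset.sum_nonneg fun k _ => sq_nonneg _).trans hgΦ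
  refine hgron.trans ((gronwallBound_neg_le ha (div_nonneg hΦ ha.le) ht).trans_eq ?_)
  rw [div_div, ← pow_two]

/-! ### §3 The `liminf` shift twin for bounded observables (H5, H6) -/

/-- **H5.** `liminf` along `atTop` does not see a translation of the argument (twin of the tree's
`limsup_comp_add_right_atTop`). [folklore] -/
theorem liminf_comp_add_right_atTop (A : ℝ → ℝ) (s : ℝ) :
    liminf (fun T => A (T + s)) atTop = liminf A atTop := by
  have hmap : map (fun T : ℝ => T + s) atTop = atTop := (OrderIso.addRight s).map_atTop
  conv_rhs => rw [← hmap]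
  simp only [liminf_eq, eventually_map]

/-- **H6 (liminf twin of `longTimeAvgSup_comp_add_right`, BOUNDED observables).** For `|φ| ≤ M`
on `[0,∞)`, locally integrable there, and `s ≥ 0`: `longTimeAvgInf (φ(·+s)) = longTimeAvgInf φ`.
The running means differ from the translated means `T ↦ timeMean φ (T+s)` by
`(s/T)·timeMean φ (T+s) - T⁻¹∫₀ˢφ = O(1/T)` (`timeMean_comp_add_right`, `abs_timeMean_le`), and
`liminf` is invariant under `T ↦ T + s` (H5) and under `o(1)` perturbations of bounded families
(`liminf_le_liminf`, `liminf_add_const`). FMRT 2001 Ch. IV §3.1; Doering–Foias 2002 §2. [folklore] -/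
theorem longTimeAvgInf_comp_add_right_of_abs_le {φ : ℝ → ℝ} {s M : ℝ} (hs : 0 ≤ s)
    (hM : ∀ t, 0 ≤ t → |φ t| ≤ M)
    (hint : ∀ a b : ℝ, 0 ≤ a → a ≤ b → IntervalIntegrable φ volume a b) :
    longTimeAvgInf (fun t => φ (t + s)) = longTimeAvgInf φ := by
  set I : ℝ := ∫ t in (0 : ℝ)..s, φ t with hI
  set A : ℝ → ℝ := timeMean φ with hA
  set B : ℝ → ℝ := timeMean fun t => φ (t + s) with hB
  have hid : ∀ T, 0 < T → B T = (T + s) / T * A (T + s) - T⁻¹ * I := fun T hT =>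
    timeMean_comp_add_right hs hT (hint 0 s le_rfl hs) (hint s (T + s) hs (by linarith))
  have hAabs : ∀ T, 0 < T → |A T| ≤ M := fun T hT =>
    abs_timeMean_le hT fun t ht _ => hM t ht.le
  -- the two mean families differ by `O(1/T)`
  have hdiff : Tendsto (fun T => B T - A (T + s)) atTop (𝓝 0) := by
    have hup : Tendsto (fun T : ℝ => (s * M + |I|) * T⁻¹) atTop (𝓝 0) := by
      simpa using tendsto_inv_atTop_zero.const_mul (s * M + |I|)
    refine squeeze_zero_norm' ?_ hup
    filter_upwards [eventually_gt_atTop (0 : ℝ)] with T hT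
    have hAT := hAabs (T + s) (by linarith)
    rw [hid T hT, Real.norm_eq_abs]
    have h1 : (T + s) / T * A (T + s) - T⁻¹ * I - A (T + s) = (s * A (T + s) - I) * T⁻¹ := by
      field_simp
      ring
    rw [h1, abs_mul, abs_of_pos (inv_pos.2 hT)]
    refine mul_le_mul_of_nonneg_right ?_ (inv_pos.2 hT).le
    calc |s * A (T + s) - I| ≤ |s * A (T + s)| + |I| := abs_sub _ _
      _ = s * |A (T + s)| + |I| := by rw [abs_mul, abs_of_nonneg hs]
      _ ≤ s * M + |I| := by gcongr
  -- boundedness data for the `liminf` algebra (no junk branch: everything lives in `[-M, M]`)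
  have hBbelow : IsBoundedUnder (· ≥ ·) atTop B :=
    isBoundedUnder_ge_timeMean (C := M) fun t ht => hM (t + s) (by linarith)
  have hBabove : IsBoundedUnder (· ≤ ·) atTop B :=
    isBoundedUnder_le_timeMean (C := M) fun t ht => hM (t + s) (by linarith)
  have hASbelow : IsBoundedUnder (· ≥ ·) atTop (fun T => A (T + s)) :=
    isBoundedUnder_of_eventually_ge (a := -M) (by
      filter_upwards [eventually_gt_atTop (0 : ℝ)] with T hT
      exact (abs_le.1 (hAabs (T + s) (by linarith))).1)
  have hASabove : IsBoundedUnder (· ≤ ·) atTop (fun T => A (T + s)) :=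
    isBoundedUnder_of_eventually_le (a := M) (by
      filter_upwards [eventually_gt_atTop (0 : ℝ)] with T hT
      exact (abs_le.1 (hAabs (T + s) (by linarith))).2)
  have hev : ∀ ε : ℝ, 0 < ε → (∀ᶠ T in atTop, B T ≤ A (T + s) + ε) ∧
      ∀ᶠ T in atTop, A (T + s) ≤ B T + ε := by
    intro ε hε
    have h := (Metric.tendsto_nhds.1 hdiff) ε hε
    constructor
    · filter_upwards [h] with T hT
      rw [Real.dist_eq, sub_zero, abs_lt] at hT
      linarith [hT.2]
    · filter_upwards [h] with T hT
      rw [Real.dist_eq, sub_zero, abs_lt] at hT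
      linarith [hT.1]
  unfold longTimeAvgInf
  rw [← liminf_comp_add_right_atTop A s]
  refine le_antisymm (le_of_forall_pos_le_add fun ε hε => ?_)
    (le_of_forall_pos_le_add fun ε hε => ?_)
  · calc liminf B atTop ≤ liminf (fun T => A (T + s) + ε) atTop :=
          liminf_le_liminf (hev ε hε).1 hBbelow
            (isBoundedUnder_le_add hASabove isBoundedUnder_const).isCoboundedUnder_ge
      _ = liminf (fun T => A (T + s)) atTop + ε :=
          liminf_add_const atTop _ ε hASabove.isCoboundedUnder_ge hASbelow
  · calc liminf (fun T => A (T + s)) atTop ≤ liminf (fun T => B T + ε) atTop :=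
          liminf_le_liminf (hev ε hε).2 hASbelow
            (isBoundedUnder_le_add hBabove isBoundedUnder_const).isCoboundedUnder_ge
      _ = liminf B atTop + ε := liminf_add_const atTop _ ε hBabove.isCoboundedUnder_ge hBbelow

/-- **H6'** (the nonnegative form used by the k1/k2 assemblies). [folklore] -/
theorem longTimeAvgInf_comp_add_right_of_bounded {φ : ℝ → ℝ} {s C : ℝ}
    (h0 : ∀ t, 0 ≤ t → 0 ≤ φ t) (hC : ∀ t, 0 ≤ t → φ t ≤ C) (hs : 0 ≤ s)
    (hint : ∀ a b, 0 ≤ a → a ≤ b → IntervalIntegrable φ volume a b) :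
    longTimeAvgInf (fun t => φ (t + s)) = longTimeAvgInf φ :=
  longTimeAvgInf_comp_add_right_of_abs_le hs
    (fun t ht => by rw [abs_of_nonneg (h0 t ht)]; exact hC t ht) hint

/-! ### §4 Bookkeeping (H7: dictionary, autonomy, force mass, punctured ball, continuity) -/

/-- H7a: the crux's solution notion is `IsGalerkinODESolution` minus the `rfl` datum clause. -/
theorem isCoeffTrajectory_iff {S : Finset ℤ³} {ν : ℝ} {g : ℤ³ → ℂ³} {c : ℝ → ↥S → ℂ³} :
    IsCoeffTrajectory S ν g c ↔ IsGalerkinODESolution ν (fun k : ↥S => g k) (c 0) c :=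
  ⟨fun h => ⟨rfl, h.1, h.2.1, h.2.2⟩, fun h => ⟨h.mem, h.continuousOn, h.hasDerivWithinAt⟩⟩

/-- H7b: autonomy — time shifts of trajectories are trajectories (`IsGalerkinODESolution.comp_add`). -/
theorem IsCoeffTrajectory.comp_add {S : Finset ℤ³} {ν : ℝ} {g : ℤ³ → ℂ³} {c : ℝ → ↥S → ℂ³}
    (hc : IsCoeffTrajectory S ν g c) {s : ℝ} (hs : 0 ≤ s) :
    IsCoeffTrajectory S ν g (fun t => c (t + s)) := by
  have h := (isCoeffTrajectory_iff.1 hc).comp_add hs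
  exact ⟨h.mem, h.continuousOn, h.hasDerivWithinAt⟩

/-- H7c: the force seen by any truncation is bounded by the full band energy `Σ_{freqBall N}‖g k‖²`
(proof from k1). -/
theorem sum_norm_sq_restrict_le {N : ℕ} {g : ℤ³ → ℂ³} (hsupp : ∀ k, k ∉ freqBall N → g k = 0)
    (S : Finset ℤ³) : ∑ k : ↥S, ‖g k‖ ^ 2 ≤ ∑ k ∈ freqBall N, ‖g k‖ ^ 2 := by
  rw [Finset.sum_coe_sort S (fun k => ‖g k‖ ^ 2),
    ← Finset.sum_filter_add_sum_filter_not S (fun k => k ∈ freqBall N)]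
  have hz : ∑ k ∈ S.filter (fun k => ¬ k ∈ freqBall N), ‖g k‖ ^ 2 = 0 :=
    Finset.sum_eq_zero fun k hk => by
      rw [hsupp k (Finset.mem_filter.1 hk).2, norm_zero, zero_pow two_ne_zero]
  rw [hz, add_zero]
  exact Finset.sum_le_sum_of_subset_of_nonneg (fun k hk => (Finset.mem_filter.1 hk).2)
    fun _ _ _ => sq_nonneg _

/-- H7d: symmetry of the punctured ball. -/
theorem neg_mem_of_mem_erase_freqBall {K : ℕ} :
    ∀ k ∈ (freqBall (d := Fin 3) K).erase 0, -k ∈ (freqBall (d := Fin 3) K).erase 0 := by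
  intro k hk
  rw [Finset.mem_erase] at hk ⊢
  exact ⟨neg_ne_zero.2 hk.1, neg_mem_freqBall_of_mem k hk.2⟩

/-- H7e: continuity of the modal energy along a trajectory. -/
theorem continuousOn_modalEnergy {S : Finset ℤ³} {c : ℝ → ↥S → ℂ³} (hc : ContinuousOn c (Ici 0)) :
    ContinuousOn (fun t => modalEnergy (c t)) (Ici 0) := by
  unfold modalEnergy
  refine continuousOn_finsetSum _ fun k _ => ?_
  exact (((continuous_apply k).comp_continuousOn hc).norm).pow 2

/-- H7e: continuity of the resolved dissipation along a trajectory. -/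
theorem continuousOn_resolvedDissipation {S : Finset ℤ³} (ν : ℝ) (M : ℕ) {c : ℝ → ↥S → ℂ³}
    (hc : ContinuousOn c (Ici 0)) :
    ContinuousOn (fun t => resolvedDissipation ν M (c t)) (Ici 0) := by
  unfold resolvedDissipation
  refine continuousOn_const.mul (continuousOn_const.mul (continuousOn_finsetSum _ fun k _ => ?_))
  by_cases hk : freqNormSq (k : ℤ³) ≤ (M : ℝ) ^ 2
  · simp only [if_pos hk]
    exact continuousOn_const.mul ((((continuous_apply k).comp_continuousOn hc).norm).pow 2)
  · simp only [if_neg hk]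
    exact continuousOn_const

/-- H7f: nonnegativity of the resolved dissipation. -/
theorem resolvedDissipation_nonneg {S : Finset ℤ³} {ν : ℝ} (hν : 0 ≤ ν) (M : ℕ) (a : ↥S → ℂ³) :
    0 ≤ resolvedDissipation ν M a := by
  unfold resolvedDissipation
  refine mul_nonneg hν (mul_nonneg (by positivity) (Finset.sum_nonneg fun k _ => ?_))
  split_ifs
  · exact mul_nonneg (freqNormSq_nonneg _) (sq_nonneg _)
  · exact le_rfl

/-- H7f: resolved dissipation is controlled by `M²` times the energy (K-uniform bound inside the ball). -/
theorem resolvedDissipation_le {S : Finset ℤ³} {ν : ℝ} (hν : 0 ≤ ν) (M : ℕ) (a : ↥S → ℂ³) :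
    resolvedDissipation ν M a ≤ ν * (4 * Real.pi ^ 2 * ((M : ℝ) ^ 2 * modalEnergy a)) := by
  unfold resolvedDissipation modalEnergy
  refine mul_le_mul_of_nonneg_left (mul_le_mul_of_nonneg_left ?_ (by positivity)) hν
  rw [Finset.mul_sum]
  refine Finset.sum_le_sum fun k _ => ?_
  split_ifs with hk
  · exact mul_le_mul_of_nonneg_right hk (sq_nonneg _)
  · positivity

/-- H7e: interval integrability of a function continuous on `[0, ∞)` over `[a, b] ⊆ [0, ∞)`. -/
theorem intervalIntegrable_of_continuousOn_Ici {φ : ℝ → ℝ} (hφ : ContinuousOn φ (Ici 0)) {a b : ℝ}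
    (ha : 0 ≤ a) (hab : a ≤ b) : IntervalIntegrable φ volume a b :=
  (hφ.mono (by rw [uIcc_of_le hab]; exact fun t ht => ha.trans ht.1)).intervalIntegrable

/-! ### §5 Assembly: the registered stub -/

/-- **`stub_absorbedWitness`** (k3's kernel-checked assembly): `B := G²/(4π²ν)² + 1`,
`G² = Σ_{freqBall N}‖g k‖²`; shift the premise witness by its explicit entrance time
`t₀ = ψ(0)/(4π²ν)` (`ψ0·e^{-ψ0} ≤ 1`); `limsup` by the tree lemma, `liminf` by H6. -/
theorem stub_absorbedWitness : Sig.stub_absorbedWitness := by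
  intro ν hν N g hcs hsupp hg0 htr
  have ha : 0 < 4 * Real.pi ^ 2 * ν := by positivity
  refine ⟨(∑ k ∈ freqBall N, ‖g k‖ ^ 2) / (4 * Real.pi ^ 2 * ν) ^ 2 + 1, ?_⟩
  intro E ε M K S hS hprem
  obtain ⟨c, hc, hsup, hinf⟩ := hprem
  -- structure of `S`
  have hSsymm : ∀ k ∈ S, -k ∈ S := by
    rw [hS]; exact neg_mem_of_mem_erase_freqBall
  have h0S : (0 : ℤ³) ∉ S := by rw [hS]; simp
  have hgr : IsRealCoeff (S := S) (fun k => g k) := isRealCoeff_restrict hcs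
  have hgG : ∑ k : ↥S, ‖g k‖ ^ 2 ≤ ∑ k ∈ freqBall N, ‖g k‖ ^ 2 := sum_norm_sq_restrict_le hsupp S
  have hsol : IsGalerkinODESolution ν (fun k : ↥S => g k) (c 0) c := isCoeffTrajectory_iff.1 hc
  set Gsq : ℝ := ∑ k ∈ freqBall N, ‖g k‖ ^ 2 with hGsq
  set ψ0 : ℝ := ∑ k, ‖c 0 k‖ ^ 2 with hψ0_def
  have hψ0 : 0 ≤ ψ0 := Finset.sum_nonneg fun _ _ => sq_nonneg _
  have hGsq0 : 0 ≤ Gsq := Finset.sum_nonneg fun _ _ => sq_nonneg _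
  -- H4 along `c`
  have hdecay : ∀ t, 0 ≤ t → modalEnergy (c t) ≤
      ψ0 * Real.exp (-(4 * Real.pi ^ 2 * ν) * t) + Gsq / (4 * Real.pi ^ 2 * ν) ^ 2 :=
    fun t ht => modalEnergy_le_exp hSsymm h0S hν hgr hsol hgG ht
  have hbound0 : ∀ t, 0 ≤ t → modalEnergy (c t) ≤ ψ0 + Gsq / (4 * Real.pi ^ 2 * ν) ^ 2 := by
    intro t ht
    have h1 : Real.exp (-(4 * Real.pi ^ 2 * ν) * t) ≤ 1 := by
      rw [Real.exp_le_one_iff]; nlinarith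
    have h2 := mul_le_mul_of_nonneg_left h1 hψ0
    linarith [hdecay t ht]
  -- explicit entrance time `t₀ = ψ0 / (4π²ν)`: `ψ0 · e^{-ψ0} ≤ 1`
  set t₀ : ℝ := ψ0 / (4 * Real.pi ^ 2 * ν) with ht₀_def
  have ht₀ : 0 ≤ t₀ := div_nonneg hψ0 ha.le
  have hkey : ψ0 * Real.exp (-(4 * Real.pi ^ 2 * ν) * t₀) ≤ 1 := by
    have h1 : -(4 * Real.pi ^ 2 * ν) * t₀ = -ψ0 := by
      rw [ht₀_def]; field_simp
    rw [h1]
    have h2 : ψ0 + 1 ≤ Real.exp ψ0 := Real.add_one_le_exp ψ0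
    have h3 : Real.exp (-ψ0) * Real.exp ψ0 = 1 := by rw [← Real.exp_add]; simp
    have h4 : 0 < Real.exp (-ψ0) := Real.exp_pos _
    nlinarith
  refine ⟨fun t => c (t + t₀), hc.comp_add ht₀, ?_, ?_, ?_⟩
  · -- confinement in the K-uniform ball from time 0
    intro t ht
    have h := hdecay (t + t₀) (by positivity)
    have hmono : Real.exp (-(4 * Real.pi ^ 2 * ν) * (t + t₀)) ≤
        Real.exp (-(4 * Real.pi ^ 2 * ν) * t₀) := Real.exp_le_exp.2 (by nlinarith)
    have h2 := mul_le_mul_of_nonneg_left hmono hψ0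
    show modalEnergy (c (t + t₀)) ≤ Gsq / (4 * Real.pi ^ 2 * ν) ^ 2 + 1
    linarith
  · -- `limsup` energy: shift invariance (tree)
    have heq := longTimeAvgSup_comp_add_right (φ := fun t => modalEnergy (c t)) (s := t₀)
      (fun t => Finset.sum_nonneg fun _ _ => sq_nonneg _) ht₀
      (fun a b ha' hab => intervalIntegrable_of_continuousOn_Ici (continuousOn_modalEnergy hc.2.1) ha' hab)
    exact heq.trans_le hsup
  · -- `liminf` resolved dissipation: bounded observable, H6
    have hbd : ∀ t, 0 ≤ t → |resolvedDissipation ν M (c t)| ≤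
        ν * (4 * Real.pi ^ 2 * ((M : ℝ) ^ 2 * (ψ0 + Gsq / (4 * Real.pi ^ 2 * ν) ^ 2))) := by
      intro t ht
      rw [abs_of_nonneg (resolvedDissipation_nonneg hν.le M (c t))]
      refine (resolvedDissipation_le hν.le M (c t)).trans ?_
      gcongr
      exact hbound0 t ht
    have heq := longTimeAvgInf_comp_add_right_of_abs_le (φ := fun t => resolvedDissipation ν M (c t))
      ht₀ hbd (fun a b ha' hab =>
        intervalIntegrable_of_continuousOn_Ici (continuousOn_resolvedDissipation ν M hc.2.1) ha' hab)
    exact hinf.trans_eq heq.symm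

end Summit.AnomalousDissipation.AnomalousDissipation.Cruxes.UniformEquilibration.StubPlan

end
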